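import Summits.AtomisticToContinuum.FouriersLaw.Theorems.BondHeatUncertaintySubdiffusiveBondHeatIffBoundedResponse
import Summits.AtomisticToContinuum.FouriersLaw.Theorems.BondHeatUncertaintySubdiffusiveBondHeatEscapeDeficitLeOne

/-!
# `EscapeGrading` — the graded census of the N_F blocker `BoundedResponse` (11071)  (lens-1 «grading», gen 55)

Node of the N_F branch (`FouriersLaw`), RESIDUAL MODE, blocker first.  The blocker is
`BondHeatUncertainty.BoundedResponse` (stmt-AtomisticToContinuum-11071): at every fixed temperature `T > 0` the finite-length
response coefficients `D_N(T)` of the pinned anharmonic chain are bounded in `N`.  By the landed equivalence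
`boundedResponse_iff_ohmicFloor` (this namespace, p-landed; response identity `D_N = (N−1)γE_N` + weak-NESS uniqueness +
`0 ≤ E_N`) the blocker IS the Ohmic floor of ONE equilibrium scalar, the ESCAPE DEFICIT
`E_N(T) = 1 − (γ/T²)∫₀^∞ K_N(u) du ∈ [0,1]` (`K_N` = boundary kinetic autocorrelation; tree: `escapeDeficit_nonneg` (imported) and
`escapeDeficit_le_one` (file `…EscapeDeficitLeOne`, landed 2026-08-17; imported and used BY NAME)):  `OhmicFloor : E_N(T) ≤ C₁(T)/N`.  This file grades that scalar along the three axes that are NOT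
already an item of the sub-problem (axis census of 13 axes in the node excerpt; series/dyadic = Fekete birth line 11748 ∧ 9127,
time horizon = 13199/13200/14070/12235/12236, profile = ProfileLadder/LocalOhmBV, Hermite degree = HermiteLadder, dilution =
12794, noise/probe ladders, Stieltjes = ContactStieltjesMeasure, bias = 13979, single-time budgets = lineage g52–g54 are all BOOKED):

## I. The exponent ladder `ExponentFloor a` :  `E_N(T) ≤ C(T)·N^{−a}`   (ON PATH; smaller `a` = weaker)
* `a ≤ 0`  PROVED (`exponentFloor_zero_of_le_one : F(0)` from the tree theorem `escapeDeficit_le_one` by name; also from the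
  ceiling: `exponentFloor_zero_of_ceiling`; `exponentFloor_anti`).
* `a = 1`  ⟺ `OhmicFloor` ⟺ 11071 (`exponentFloor_one_iff_boundedResponse`) — EQUIV layer, admissible once.
* `0 < a < 1` UNDECIDED · IDEA-NEEDED: no owner in the tree; the graded content of the CET split 11071 ⟸ `NoBallisticChannel`
  28286 (`D_N/N → 0`, = `a = 0⁺`) ∧ `NoAnomalousChannel` 28285 ("sub-ballistic ⇒ bounded", whose why-might-fail IS an anomalous
  exponent `D_N ~ N^{1−a}`).  For every `a ∈ (0,1)`:  11071 ⟸ `ExponentFloor a` ∧ `ExponentBootstrap a`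
  (`boundedResponse_of_floor_bootstrap`), both pieces STRICTLY WEAKER than 11071 (`ExponentFloor a` ⟸ 11071 by `exponentFloor_anti`;
  `ExponentBootstrap a` ⟸ 11071 trivially) — a formally genuine split WITHOUT an attackable half (neither piece has a technique
  that does not also prove 11071: the only known mechanisms for a power gain are the Ohmic ones).  VERDICT: NOT a node of record;
  typed so that the exponent axis is priced once.  `HalfOhmicFloor` (`a = 1/2`) is singled out because two independent heuristics
  land exactly there (excerpt §1: the light-cone split of `∫K_N` at `τ = N/v`, and the Hermite-sector Cauchy–Schwarz bound of the
  boundary Fisher information) — both give `N^{−1/2}` and no more.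

## II. The variational ceiling (ON PATH, the `a = 0` rung SHARPENED; ATTACKABLE·M, NEW)
`ContactVariationalCeiling`:  `E_N(T) ≤ κ_L/(γ²T + 2κ_L)` for every `N ≥ 2`, `κ_L = E_{μ_T}[V'(q₁ − q₀)²]`, `V'(r) = r + βr³`.
Mechanism (excerpt §1): `E_N = 1 − (γ/T²)⟨θ₀,(−L)⁻¹θ₀⟩`, `θ₀ = p₀² − T`, and for `L = S + A_H` (`S` = the two Ornstein–Uhlenbeck
thermostats, `A_H` = Liouville) the Schur-complement variational principle
`⟨θ₀,(−L)⁻¹θ₀⟩ = sup_g {2⟨θ₀,g⟩ − ⟨g,(−S)g⟩ − ‖A_H g‖²_{−1,S}}` [BernardinOlla2011 §4 Prop. 4 (bulk-noise version);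
KipnisLandim1999 p.144 (reversible version)] turns EVERY admissible test function into an UPPER bound on `E_N` — the direction
11071 needs.  With boundary-only noise ADMISSIBILITY is severe: `‖A_H g‖_{−1,S} < ∞` iff `{H,g}` is conditionally centred in the
two bath momenta for a.e. value of all other coordinates; a hydrodynamic test function `Σ a_x e_x` (site energies) is admissible only
when all `a_x` are equal (`g ∝ H`: every bond current `½(p_x + p_{x+1})V'(r_x)` carries a non-bath momentum), and the 2-parameter family
`g = aH + b(p₀²/2 + U(q₀))` (admissible:
`{H, p₀²/2 + U(q₀)} = p₀V'(q₁−q₀)`, an eigenfunction of `−S` with eigenvalue `γ`) has the explicit optimum displayed.  Checked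
against the exactly solvable harmonic member (excerpt §1 table: `E_N = 0.125 ≤ 0.276` at `ω₂ = γ = 1`, …, `0.4535 ≤ 0.4885` at
`ω₂ = 0.25, γ = 0.2`; the symmetric 3-parameter sharpening `g = aH + b h₀ + b' h_{N−1}` gives `E_N ≤ κ_L/(2(γ²T + κ_L))`
(`κ_R = κ_L` by reflection): `0.125 ≤ 0.191`, `0.4535 ≤ 0.4775`).  Corollary
`escapeDeficit_lt_half_of_ceiling`: strictly less than half of a boundary energy fluctuation escapes through the far bath, at every
`T` and `N`.  WHY STRICTLY WEAKER than 11071: it is `N`-independent (an `a = 0` statement) and TRUE at the harmonic member, where 11071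
is false.  WHY IT MATTERS: (i) it is the only UPPER-bound principle for `E_N` in the tree that is not an identity; (ii) its
admissibility lemma is the precise form of the «no sign principle» obstruction: to reach `1 − E_N = O(1)·(1 − C/N)` the test function
must be an approximate invariant of the BULK Hamiltonian flow modulo the bath momenta — for an integrable bulk such invariants abound
(and `E_N^{harm}` stays `O(1)`), for a chaotic bulk only `H` is available in closed form (barrier note B-g55-1 in the excerpt).

## III. The persistence (negative) ladder `HarmonicPersistenceWindow α`  (BARRIER side; larger `α` = weaker)
`∃ e, θ > 0: E_N(T) ≥ e` whenever `T·N^α ≤ θ` (`N ≥ N₀`): the ballistic harmonic value persists in a low-temperature window.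
* `α = ∞`  `PointwiseHarmonicLimit` (fixed `N`, `T → 0`): ⟸ `HarmonicEscapeFloor` ∧ `LowTemperatureContinuity`
  (`pointwiseHarmonicLimit_of_floor_continuity`), BOTH ATTACKABLE·M (harmonic GK value `c_N/γ ≥ c_∞/(2γ)` from the vendored
  `HarmonicChainBallisticFlux`; fixed-`N` continuity of one resolvent matrix element along the scaling ray `(lamT, βT) → (0,0)`,
  CEHRB 2018 Thm 2.13 class) — the one GENUINE two-piece split with two attackable halves found at gen 55; it lives on the negative
  side.  Consequence `not_uniformOhmicFloor_of_pointwise`: the Ohmic constant of 11071 CANNOT be chosen uniformly on any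
  low-temperature interval — the finite-`N`, unconditional form of clause (ii) of the catalogued barrier
  `Literature.Barriers.AtomisticToContinuum.LowTemperatureWeakAnharmonicity` ("PREDICTED to fail … not refuted"), promoted to a
  provable statement.
* `α > 3`  ATTACKABLE·L (perturbation about the boundary-damped harmonic flow over its relaxation time `N³`: the class of
  [Lu 2026, arXiv:2607.13953, Assumption 2.5 (17) `N³‖∇²W_N‖_∞ ≤ θ₀`, Thms 2.4/2.6; Menegaki 2020] — a BOUNDED-Hessian smallness
  hypothesis, which the quartic chain in scaled variables (couplings `lamT`, `βT`) meets only after a truncation step using the Gibbs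
  tails; quantitative price of 11071 under the rung: `C₁(T) ≥ e·⌊(θ/T)^{1/α}⌋`).
* `1/2 < α ≤ 3` IDEA-NEEDED (kinetic regime, mean free path `(λT)⁻² ≫ N`; owner of the cell `α = 1/2`: KineticCorner 3430/3431,
  OnsetOfResistance 4769); `α < 1/2` FALSE in evidence (diffusive onset).  As `α ↓ 1/2` the price `C₁(T) ≳ T^{−1/α}` tends to the
  Aoki–Lukkarinen–Spohn law `κ ~ (λT)⁻²` read as a LOWER bound on the Ohmic constant.
Seams: `harmonicPersistenceWindow_mono`, `pointwiseHarmonicLimit_of_window`, `pointwiseHarmonicLimit_of_floor_continuity`,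
`not_uniformOhmicFloor_of_pointwise`, `not_uniformOhmicFloor_of_window`.

VERDICT OF THE GENERATION (honest): along every grading axis the first rung that is not already a theorem-or-routine is 11071-hard
(I), or the ladder grades the instrument / the negative side (II, III).  No graded family splits 11071 with an attackable next
grade; the N_F residual of record is UNCHANGED (11071 ∧ 9121).  New attackable content: `ContactVariationalCeiling` (S–M),
`HarmonicEscapeFloor` (M), `LowTemperatureContinuity` (M), hence `PointwiseHarmonicLimit` and `¬UniformOhmicFloor`.
No `sorry`; nothing here closes an item.  Tags: [piece · rung] on the `Prop`s, [folklore] on the seams.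
-/

noncomputable section

open MeasureTheory Filter Topology Set
open Literature.MathematicalPhysics.KineticTheory.HeatConduction

namespace Summit.AtomisticToContinuum.FouriersLaw.Theorems.SubdiffusiveBondHeat

namespace EscapeGrading

open Summit.AtomisticToContinuum.FouriersLaw.Theses.BondHeatUncertainty (BoundedResponse)

/-! ## The graded scalar -/

/-- **The escape deficit `E_N(T)`** — VERBATIM the inline expression of `boundedResponse_iff_ohmicFloor`, `escapeDeficit_nonneg`,
`escapeDeficit_le_one` (the `let E` of route `BoundaryEscapeDeficit`, `dite` included; junk value `1` at `N = 0`):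
`E_N = 1 − (γ/T²)∫_{(0,∞)} K_N(u) du`, `K_N(u) = ∫ (p₀² − T)·P_u(p₀² − T) dμ_T^N`. [folklore] -/
def escapeDeficit (ω₂ lam β γ T : ℝ) (N : ℕ) : ℝ :=
  1 - γ / T ^ 2 * (∫ u in Set.Ioi (0 : ℝ),
    if h : 0 < N then
      ∫ z, ((z.2 ⟨0, h⟩) ^ 2 - T) *
          (∫ y, ((y.2 ⟨0, h⟩) ^ 2 - T) ∂((pinnedChain ω₂ lam β γ).transitionKernel N T T u.toNNReal z))
        ∂((pinnedChain ω₂ lam β γ).gibbsMeasure N T)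
    else 0)

/-- `0 ≤ E_N` for `N ≥ 2` (tree: `escapeDeficit_nonneg`, p139693), in the functional's spelling. [folklore] -/
theorem escapeDeficit_nonneg' {ω₂ lam β γ : ℝ} (hω : 0 < ω₂) (hl : 0 < lam) (hβ : 0 < β) (hγ : 0 < γ)
    {T : ℝ} (hT : 0 < T) {N : ℕ} (hN : 2 ≤ N) : 0 ≤ escapeDeficit ω₂ lam β γ T N :=
  escapeDeficit_nonneg ω₂ lam β γ hω hl hβ hγ T hT N hN

/-- **The Ohmic floor at the contact** (`E_N(T) ≤ C₁(T)/N` eventually in `N`, constant per temperature) — VERBATIM the right-hand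
side of `boundedResponse_iff_ohmicFloor`; EQUIVALENT to the blocker 11071 (`ohmicFloor_iff_boundedResponse`).
Tag: EQUIV · COSTUME of 11071 (admissible once as the layer under which the ladders hang). [piece · equiv] -/
def OhmicFloor : Prop :=
  ∀ ω₂ lam β γ : ℝ, 0 < ω₂ → 0 < lam → 0 < β → 0 < γ → ∀ T : ℝ, 0 < T →
    ∃ C₁ : ℝ, ∃ N₀ : ℕ, ∀ N : ℕ, N₀ ≤ N → escapeDeficit ω₂ lam β γ T N ≤ C₁ / (N : ℝ)

/-- `OhmicFloor ⟺ BoundedResponse` (11071) — the landed `boundedResponse_iff_ohmicFloor`, by name. [folklore] -/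
theorem ohmicFloor_iff_boundedResponse : OhmicFloor ↔ BoundedResponse :=
  boundedResponse_iff_ohmicFloor.symm

/-! ## I. The exponent ladder (on path) -/

/-- **Exponent rung `F(a)`:** `∀ T > 0 ∃ C N₀ ∀ N ≥ N₀, E_N(T) ≤ C / N^a` (real exponent; smaller `a` = WEAKER).
Tags: `a ≤ 0` PROVED (`exponentFloor_zero`, `exponentFloor_anti`); `a = 1` ⟺ 11071 (`exponentFloor_one_iff_boundedResponse`);
`0 < a < 1` UNDECIDED · IDEA-NEEDED (graded content of CET 28285/28286; no owner; no technique short of the Ohmic ones);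
`a > 1` STRONGER than 11071 and FALSE in evidence (`E_N ≍ κ/(γN)`, BLR (33)). [piece · rung] -/
def ExponentFloor (a : ℝ) : Prop :=
  ∀ ω₂ lam β γ : ℝ, 0 < ω₂ → 0 < lam → 0 < β → 0 < γ → ∀ T : ℝ, 0 < T →
    ∃ C : ℝ, ∃ N₀ : ℕ, ∀ N : ℕ, N₀ ≤ N → escapeDeficit ω₂ lam β γ T N ≤ C / (N : ℝ) ^ a

/-- The exponent-`1/2` rung, named: `E_N(T) ≤ C/√N`.  UNDECIDED · IDEA-NEEDED; the landing point of the light-cone split and of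
the Hermite-sector bound (node excerpt §1); implies `NonBallistic` 9127-type statements, implied by 11071. [piece · rung] -/
def HalfOhmicFloor : Prop := ExponentFloor (1 / 2 : ℝ)

/-- **`F(0)` from the tree theorem `E_N ≤ 1`** (`= 1/N^0`; `escapeDeficit_le_one` by name). [folklore] -/
theorem exponentFloor_zero_of_le_one : ExponentFloor 0 := by
  intro ω₂ lam β γ hω hl hβ hγ T hT
  refine ⟨1, 0, fun N _ => ?_⟩
  rw [Real.rpow_zero, div_one]
  exact escapeDeficit_le_one ω₂ lam β γ hω hl hβ hγ T hT N

/-- **Monotonicity of the exponent ladder**: `a ≤ b ⟹ F(b) ⟹ F(a)` (for `N ≥ 1`, `N^a ≤ N^b`; constant `max C 0`). [folklore] -/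
theorem exponentFloor_anti {a b : ℝ} (hab : a ≤ b) : ExponentFloor b → ExponentFloor a := by
  intro h ω₂ lam β γ hω hl hβ hγ T hT
  obtain ⟨C, N₀, hC⟩ := h ω₂ lam β γ hω hl hβ hγ T hT
  refine ⟨max C 0, max N₀ 1, fun N hN => ?_⟩
  have hN₀ : N₀ ≤ N := le_trans (le_max_left _ _) hN
  have hN1 : (1 : ℝ) ≤ (N : ℝ) := by exact_mod_cast le_trans (le_max_right _ _) hN
  have hNpos : (0 : ℝ) < (N : ℝ) := lt_of_lt_of_le zero_lt_one hN1
  have hpa : 0 < (N : ℝ) ^ a := Real.rpow_pos_of_pos hNpos a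
  have hpb : 0 < (N : ℝ) ^ b := Real.rpow_pos_of_pos hNpos b
  have hab' : (N : ℝ) ^ a ≤ (N : ℝ) ^ b := Real.rpow_le_rpow_of_exponent_le hN1 hab
  calc escapeDeficit ω₂ lam β γ T N ≤ C / (N : ℝ) ^ b := hC N hN₀
    _ ≤ max C 0 / (N : ℝ) ^ b := div_le_div_of_nonneg_right (le_max_left C 0) hpb.le
    _ ≤ max C 0 / (N : ℝ) ^ a := div_le_div_of_nonneg_left (le_max_right C 0) hpa hab'

/-- Every non-positive exponent rung follows from `E_N ≤ 1`. [folklore] -/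
theorem exponentFloor_of_nonpos_of_le_one {a : ℝ} (ha : a ≤ 0) : ExponentFloor a :=
  exponentFloor_anti ha exponentFloor_zero_of_le_one

/-- **`F(1)` is the Ohmic floor** (`N^1 = N`). [folklore] -/
theorem exponentFloor_one_iff_ohmicFloor : ExponentFloor 1 ↔ OhmicFloor := by
  simp only [ExponentFloor, OhmicFloor, Real.rpow_one]

/-- **`F(1)` ⟺ 11071.** [folklore] -/
theorem exponentFloor_one_iff_boundedResponse : ExponentFloor 1 ↔ BoundedResponse :=
  exponentFloor_one_iff_ohmicFloor.trans ohmicFloor_iff_boundedResponse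

/-- 11071 gives every rung `a ≤ 1` (each such rung is WEAKER than the blocker). [folklore] -/
theorem exponentFloor_of_boundedResponse {a : ℝ} (ha : a ≤ 1) : BoundedResponse → ExponentFloor a :=
  fun h => exponentFloor_anti ha (exponentFloor_one_iff_boundedResponse.2 h)

/-- **Graded bootstrap `B(a)`:** "exponent `a` upgrades to exponent `1`" — the graded form of CET's `NoAnomalousChannel` 28285
(no anomalous channel between `N^{−a}` and `N^{−1}`).  Tags: `a ≥ 1` trivial (`exponentBootstrap_of_one_le`); `a < 1`
UNDECIDED · IDEA-NEEDED (a Tauberian rigidity of the contact spectral measure would be the natural owner: CET 28287–28289,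
ContactStieltjesMeasure); implied by 11071. [piece · rung] -/
def ExponentBootstrap (a : ℝ) : Prop := ExponentFloor a → ExponentFloor 1

/-- `B(a)` is free for `a ≥ 1`. [folklore] -/
theorem exponentBootstrap_of_one_le {a : ℝ} (ha : 1 ≤ a) : ExponentBootstrap a :=
  fun h => exponentFloor_anti ha h

/-- 11071 ⟹ `B(a)` (so `B(a)` is WEAKER than the blocker). [folklore] -/
theorem exponentBootstrap_of_boundedResponse (a : ℝ) : BoundedResponse → ExponentBootstrap a :=
  fun h _ => exponentFloor_one_iff_boundedResponse.2 h

/-- **The graded CET split:** `F(a) ∧ B(a) ⟹ 11071` for every `a` (formally genuine for `0 < a < 1`; both halves planless —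
see the module docstring). [folklore] -/
theorem boundedResponse_of_floor_bootstrap (a : ℝ) : ExponentFloor a → ExponentBootstrap a → BoundedResponse :=
  fun hF hB => exponentFloor_one_iff_boundedResponse.1 (hB hF)

/-! ## II. The variational ceiling (on path; the `a = 0` rung sharpened) -/

/-- **Contact stiffness `κ_L(T, N) = E_{μ_T^N}[V'(q₁ − q₀)²]`**, `V'(r) = r + βr³` (the force through the bath bond `(0,1)`;
junk value `0` for `N ≤ 1`).  Under the Gibbs probability measure (`pinnedChain_isProbabilityMeasure_gibbsMeasure`). [folklore] -/
def contactStiffness (ω₂ lam β γ T : ℝ) (N : ℕ) : ℝ :=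
  if h : 1 < N then
    ∫ z, ((z.1 ⟨1, h⟩ - z.1 ⟨0, lt_trans zero_lt_one h⟩) +
            β * (z.1 ⟨1, h⟩ - z.1 ⟨0, lt_trans zero_lt_one h⟩) ^ 3) ^ 2
      ∂((pinnedChain ω₂ lam β γ).gibbsMeasure N T)
  else 0

/-- `0 ≤ κ_L` (integral of a square). [folklore] -/
theorem contactStiffness_nonneg (ω₂ lam β γ T : ℝ) (N : ℕ) : 0 ≤ contactStiffness ω₂ lam β γ T N := by
  unfold contactStiffness
  split_ifs
  · exact integral_nonneg fun z => sq_nonneg _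
  · exact le_rfl

/-- **The contact variational ceiling** (NEW · ATTACKABLE·M, size M):  for all parameters `> 0`, `T > 0`, `N ≥ 2`,
`E_N(T) ≤ κ_L/(γ²T + 2κ_L)`.  Route (node excerpt §1): Schur-complement variational principle for `⟨θ₀,(−L)⁻¹θ₀⟩` with the
admissible 2-parameter test family `g = aH + b(p₀²/2 + U(q₀))`: `⟨θ₀,g⟩ = (a+b)T²`, `⟨g,(−S)g⟩ = γT²((a+b)² + a²)`,
`‖{H,g}‖²_{−1,S} = b²Tκ_L/γ` (`{H, p₀²/2+U(q₀)} = p₀V'(q₁−q₀)`, `(−S)(p₀φ) = γp₀φ`), optimum `u = a+b = (γ+c)/(γ(γ+2c))`,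
`a = cu/(γ+c)`, `c = κ_L/(γT)`.  What a prover must supply: the inequality `⟨θ₀,(−L)⁻¹θ₀⟩ ≥ 2⟨θ₀,g⟩ − ⟨g,(−S)g⟩ − ‖A_Hg‖²_{−1,S}`
for this `g` (fixed `N`; Dynkin formulas for `H` and the site energy are in tree: `…SiteEnergyDynkin`, `…BathBondReductionGenerator`;
the resolvent is `∫₀^∞ P_u θ₀ du`, convergent by the fixed-`N` exponential mixing behind `escapeDeficit_le_one`).
WHY STRICTLY WEAKER than 11071: `N`-independent, and TRUE at the harmonic member (`0.125 ≤ 0.276`), where 11071 fails.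
Why it might fail: only through a domain subtlety of the variational principle for the hypoelliptic `L` (the finite-dimensional
identity is exact); the harmonic-chain table of the excerpt (6 parameter points, `N = 6–8`, exact Lyapunov solve) is consistent
with it and with its 3-parameter sharpening in 6/6 cases. [piece · rung] -/
def ContactVariationalCeiling : Prop :=
  ∀ ω₂ lam β γ : ℝ, 0 < ω₂ → 0 < lam → 0 < β → 0 < γ → ∀ T : ℝ, 0 < T → ∀ N : ℕ, 2 ≤ N →
    escapeDeficit ω₂ lam β γ T N ≤
      contactStiffness ω₂ lam β γ T N / (γ ^ 2 * T + 2 * contactStiffness ω₂ lam β γ T N)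

/-- **Corollary: strictly less than one half escapes** — `E_N(T) < 1/2` for every `N ≥ 2` (the ceiling is `< 1/2` because
`γ²T > 0`); compare the tree's `E_N ≤ 1` (`escapeDeficit_le_one`) and the test function `g = H/(2γ)` alone (`E_N ≤ 1/2`). [folklore] -/
theorem escapeDeficit_lt_half_of_ceiling (h : ContactVariationalCeiling) {ω₂ lam β γ : ℝ} (hω : 0 < ω₂) (hl : 0 < lam)
    (hβ : 0 < β) (hγ : 0 < γ) {T : ℝ} (hT : 0 < T) {N : ℕ} (hN : 2 ≤ N) :
    escapeDeficit ω₂ lam β γ T N < 1 / 2 := by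
  have hk := contactStiffness_nonneg ω₂ lam β γ T N
  have hγT : 0 < γ ^ 2 * T := by positivity
  have hden : 0 < γ ^ 2 * T + 2 * contactStiffness ω₂ lam β γ T N := by positivity
  have hlt : contactStiffness ω₂ lam β γ T N / (γ ^ 2 * T + 2 * contactStiffness ω₂ lam β γ T N) < 1 / 2 := by
    rw [div_lt_iff₀ hden]
    linarith
  exact lt_of_le_of_lt (h ω₂ lam β γ hω hl hβ hγ T hT N hN) hlt

/-- The ceiling proves the rung `F(0)` UNCONDITIONALLY here, with the explicit constant `1/2` (and `N₀ = 2`). [folklore] -/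
theorem exponentFloor_zero_of_ceiling (h : ContactVariationalCeiling) : ExponentFloor 0 := by
  intro ω₂ lam β γ hω hl hβ hγ T hT
  refine ⟨1 / 2, 2, fun N hN => ?_⟩
  rw [Real.rpow_zero, div_one]
  exact (escapeDeficit_lt_half_of_ceiling h hω hl hβ hγ hT hN).le

/-! ## III. The persistence ladder (negative side) -/

/-- **Window rung `W(α)`:** in the low-temperature window `T·N^α ≤ θ` the escape deficit keeps a positive floor `e`, uniformly:
`∃ e θ > 0 ∃ N₀ ∀ N ≥ N₀ ∀ T > 0, T·N^α ≤ θ → e ≤ E_N(T)` (larger `α` = narrower window = WEAKER, `harmonicPersistenceWindow_mono`).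
Tags: `α > 3` ATTACKABLE·L (perturbation about the boundary-damped harmonic flow over its `N³` relaxation time — the class of
Lu 2026 arXiv:2607.13953 Assumption 2.5 (17) `N³‖∇²W_N‖_∞ ≤ θ₀` / Thm 2.6, a bounded-Hessian hypothesis the scaled quartic chain
(couplings `lamT`, `βT`) meets only after truncation on the Gibbs tails); `1/2 < α ≤ 3` IDEA-NEEDED (kinetic regime); `α = 1/2` the
kinetic cell (KineticCorner 3430/3431, OnsetOfResistance 4769); `α < 1/2` FALSE in evidence.  Price of 11071 under `W(α)`:
`C₁(T) ≥ e·⌊(θ/T)^{1/α}⌋`. [piece · rung] -/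
def HarmonicPersistenceWindow (α : ℝ) : Prop :=
  ∀ ω₂ lam β γ : ℝ, 0 < ω₂ → 0 < lam → 0 < β → 0 < γ →
    ∃ e : ℝ, 0 < e ∧ ∃ θ : ℝ, 0 < θ ∧ ∃ N₀ : ℕ, ∀ N : ℕ, N₀ ≤ N → ∀ T : ℝ, 0 < T →
      T * (N : ℝ) ^ α ≤ θ → e ≤ escapeDeficit ω₂ lam β γ T N

/-- **Pointwise rung `W(∞)`** (fixed `N`, `T → 0`): `∃ e > 0 ∃ N₀ ∀ N ≥ N₀ ∃ T₀(N) > 0 ∀ T ∈ (0, T₀], e ≤ E_N(T)` — every long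
enough chain is ballistic at low enough temperature.  ⟸ `HarmonicEscapeFloor` ∧ `LowTemperatureContinuity` (both ATTACKABLE·M);
⟸ every `W(α)`.  Refutes `UniformOhmicFloor`. [piece · rung] -/
def PointwiseHarmonicLimit : Prop :=
  ∀ ω₂ lam β γ : ℝ, 0 < ω₂ → 0 < lam → 0 < β → 0 < γ →
    ∃ e : ℝ, 0 < e ∧ ∃ N₀ : ℕ, ∀ N : ℕ, N₀ ≤ N → ∃ T₀ : ℝ, 0 < T₀ ∧ ∀ T : ℝ, 0 < T → T ≤ T₀ →
      e ≤ escapeDeficit ω₂ lam β γ T N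

/-- **Harmonic escape floor** (ATTACKABLE·M): the pinned HARMONIC chain (`lam = β = 0`) has escape deficit bounded below uniformly in
large `N` (at `T = 1`; it is `T`-independent): `E_N^{harm} = c_N/γ → c_∞/γ > 0` by the response identity at the harmonic point and the
vendored RLL/Nakazawa law `Literature.Barriers.AtomisticToContinuum.HarmonicChainBallisticFlux` (`c_N → c_∞ > 0`; numerically
`E_∞^{harm} = 1/8` at `ω₂ = γ = 1`).  To supply: the Green–Kubo/response identity for the Gaussian (OU) member, or a direct OU
computation of `∫₀^∞ K_N`. Sources: RiederLebowitzLieb1967, Nakazawa1970, RoyDhar2008 §2. [piece · rung] -/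
def HarmonicEscapeFloor : Prop :=
  ∀ ω₂ γ : ℝ, 0 < ω₂ → 0 < γ →
    ∃ e : ℝ, 0 < e ∧ ∃ N₀ : ℕ, ∀ N : ℕ, N₀ ≤ N → e ≤ escapeDeficit ω₂ 0 0 γ 1 N

/-- **Low-temperature continuity at fixed `N`** (ATTACKABLE·M): `E_N(T; lam, β) → E_N(1; 0, 0)` as `T → 0⁺`, every `N ≥ 2`.
Two steps: (a) scaling covariance `E_N(T; lam, β) = E_N(1; lamT, βT)` (the conjugacy of
`Literature.Barriers.AtomisticToContinuum.lowTemperatureWeakAnharmonicity_holds`, `generator_smul` / `isSteadyState_map_smul`, pushed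
to the kernel and the Gibbs measure); (b) continuity of the fixed-`N` resolvent element `⟨θ₀,(−L_{lam',β'})⁻¹θ₀⟩_{μ_{lam',β'}}` at
`(lam',β') = (0,0)` — uniform-in-small-coupling exponential mixing of the `N`-site Langevin chain (CEHRB 2018 Thm 2.13 /
Carmona 2007 class; both potentials quartic, interaction degree ≥ pinning degree, so no Hairer–Mattingly 2009 slow-dissipation
obstruction).  Why it might fail: only if the mixing constants are not locally uniform in the couplings at the Gaussian point (not
expected at fixed `N`; "the non-equilibrium measure should be close to a gaussian one" is the infinite-volume difficulty, not the
finite one — Kupiainen in BenArous2008 p.35). [piece · rung] -/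
def LowTemperatureContinuity : Prop :=
  ∀ ω₂ lam β γ : ℝ, 0 < ω₂ → 0 < lam → 0 < β → 0 < γ → ∀ N : ℕ, 2 ≤ N →
    Tendsto (fun T : ℝ => escapeDeficit ω₂ lam β γ T N) (𝓝[>] 0) (𝓝 (escapeDeficit ω₂ 0 0 γ 1 N))

/-- **The `T`-uniform Ohmic floor** (STRONGER than 11071; FALSE given `PointwiseHarmonicLimit`): one constant `C₁` serving a whole
low-temperature interval `(0, T₀]`.  The finite-`N`, unconditional form of clause (ii) ("`sup_{0<T≤T₀} κ(T) < ∞`, PREDICTED to fail,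
not refuted") of the barrier `LowTemperatureWeakAnharmonicity`; typed so that its refutation can land
(`not_uniformOhmicFloor_of_pointwise`).  No open item of the sub-problem asserts it (scan of all `Theses/*.lean`, gen 55).
[piece · negative target] -/
def UniformOhmicFloor : Prop :=
  ∀ ω₂ lam β γ : ℝ, 0 < ω₂ → 0 < lam → 0 < β → 0 < γ →
    ∃ C₁ : ℝ, ∃ T₀ : ℝ, 0 < T₀ ∧ ∃ N₀ : ℕ, ∀ T : ℝ, 0 < T → T ≤ T₀ → ∀ N : ℕ, N₀ ≤ N →
      escapeDeficit ω₂ lam β γ T N ≤ C₁ / (N : ℝ)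

/-- `UniformOhmicFloor ⟹ OhmicFloor` on `(0, T₀]` only — recorded as the trivial comparison: the uniform floor gives the per-`T`
floor at every `T ≤ T₀` (so it is at least as strong as 11071 restricted to low temperatures). [folklore] -/
theorem ohmicFloor_lowT_of_uniform (h : UniformOhmicFloor) :
    ∀ ω₂ lam β γ : ℝ, 0 < ω₂ → 0 < lam → 0 < β → 0 < γ → ∃ T₀ : ℝ, 0 < T₀ ∧ ∀ T : ℝ, 0 < T → T ≤ T₀ →
      ∃ C₁ : ℝ, ∃ N₀ : ℕ, ∀ N : ℕ, N₀ ≤ N → escapeDeficit ω₂ lam β γ T N ≤ C₁ / (N : ℝ) := by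
  intro ω₂ lam β γ hω hl hβ hγ
  obtain ⟨C₁, T₀, hT₀, N₀, hU⟩ := h ω₂ lam β γ hω hl hβ hγ
  exact ⟨T₀, hT₀, fun T hT hTle => ⟨C₁, N₀, fun N hN => hU T hT hTle N hN⟩⟩

/-- **Monotonicity of the window ladder**: `α ≤ α' ⟹ W(α) ⟹ W(α')` (a narrower window is a weaker claim; `N ≥ 1`). [folklore] -/
theorem harmonicPersistenceWindow_mono {α α' : ℝ} (hle : α ≤ α') :
    HarmonicPersistenceWindow α → HarmonicPersistenceWindow α' := by
  intro hW ω₂ lam β γ hω hl hβ hγ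
  obtain ⟨e, he, θ, hθ, N₀, hN⟩ := hW ω₂ lam β γ hω hl hβ hγ
  refine ⟨e, he, θ, hθ, max N₀ 1, fun N hNN T hT hwin => hN N (le_trans (le_max_left _ _) hNN) T hT ?_⟩
  have hN1 : (1 : ℝ) ≤ (N : ℝ) := by exact_mod_cast le_trans (le_max_right _ _) hNN
  calc T * (N : ℝ) ^ α ≤ T * (N : ℝ) ^ α' :=
        mul_le_mul_of_nonneg_left (Real.rpow_le_rpow_of_exponent_le hN1 hle) hT.le
    _ ≤ θ := hwin

/-- **Every window rung gives the pointwise rung** (`T₀(N) = θ/N^α`). [folklore] -/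
theorem pointwiseHarmonicLimit_of_window (α : ℝ) : HarmonicPersistenceWindow α → PointwiseHarmonicLimit := by
  intro hW ω₂ lam β γ hω hl hβ hγ
  obtain ⟨e, he, θ, hθ, N₀, hN⟩ := hW ω₂ lam β γ hω hl hβ hγ
  refine ⟨e, he, max N₀ 1, fun N hNN => ?_⟩
  have hN1 : (1 : ℝ) ≤ (N : ℝ) := by exact_mod_cast le_trans (le_max_right _ _) hNN
  have hNpos : (0 : ℝ) < (N : ℝ) := lt_of_lt_of_le zero_lt_one hN1
  have hpow : 0 < (N : ℝ) ^ α := Real.rpow_pos_of_pos hNpos α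
  refine ⟨θ / (N : ℝ) ^ α, div_pos hθ hpow, fun T hT hTle => hN N (le_trans (le_max_left _ _) hNN) T hT ?_⟩
  calc T * (N : ℝ) ^ α ≤ θ / (N : ℝ) ^ α * (N : ℝ) ^ α := mul_le_mul_of_nonneg_right hTle hpow.le
    _ = θ := div_mul_cancel₀ θ hpow.ne'

/-- **The pointwise rung from its two attackable halves**: harmonic floor `e` at `lam = β = 0` and fixed-`N` continuity as `T → 0⁺`
give `E_N(T) ≥ e/2` on some `(0, T₀(N)]` for every `N ≥ max N₀ 2`. [folklore] -/
theorem pointwiseHarmonicLimit_of_floor_continuity :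
    HarmonicEscapeFloor → LowTemperatureContinuity → PointwiseHarmonicLimit := by
  intro hF hC ω₂ lam β γ hω hl hβ hγ
  obtain ⟨e, he, N₀, hN⟩ := hF ω₂ γ hω hγ
  refine ⟨e / 2, half_pos he, max N₀ 2, fun N hNN => ?_⟩
  have hN₀ : N₀ ≤ N := le_trans (le_max_left _ _) hNN
  have hN2 : 2 ≤ N := le_trans (le_max_right _ _) hNN
  have hlim := hC ω₂ lam β γ hω hl hβ hγ N hN2
  have hlt : e / 2 < escapeDeficit ω₂ 0 0 γ 1 N := by linarith [hN N hN₀]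
  have hev : ∀ᶠ T in 𝓝[>] (0 : ℝ), e / 2 < escapeDeficit ω₂ lam β γ T N := hlim.eventually (lt_mem_nhds hlt)
  obtain ⟨ε, hε, hball⟩ := Metric.eventually_nhds_iff.1 (eventually_nhdsWithin_iff.1 hev)
  refine ⟨ε / 2, half_pos hε, fun T hT hTle => le_of_lt (hball ?_ (Set.mem_Ioi.2 hT))⟩
  rw [Real.dist_eq, sub_zero, abs_of_pos hT]
  linarith

/-- **The pointwise rung refutes the `T`-uniform Ohmic floor**: pick `N ≥ N₀, N₀'` with `C₁/N < e`, then `T ≤ min T₀ T₀(N)`.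
Hence the Ohmic constant of 11071 necessarily degenerates as `T → 0⁺` (barrier clause (ii), finite-`N` form). [folklore] -/
theorem not_uniformOhmicFloor_of_pointwise : PointwiseHarmonicLimit → ¬ UniformOhmicFloor := by
  intro hP hU
  obtain ⟨e, he, N₀, hN⟩ := hP 1 1 1 1 one_pos one_pos one_pos one_pos
  obtain ⟨C₁, T₀, hT₀, N₁, hU1⟩ := hU 1 1 1 1 one_pos one_pos one_pos one_pos
  obtain ⟨M, hM⟩ := exists_nat_gt (C₁ / e)
  obtain ⟨T₁, hT₁, hPT⟩ := hN (max (max N₀ N₁) (max M 1)) (le_trans (le_max_left _ _) (le_max_left _ _))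
  set N : ℕ := max (max N₀ N₁) (max M 1) with hNdef
  have hN₁ : N₁ ≤ N := le_trans (le_max_right _ _) (le_max_left _ _)
  have hMN : M ≤ N := le_trans (le_max_left _ _) (le_max_right _ _)
  have hN1 : 1 ≤ N := le_trans (le_max_right _ _) (le_max_right _ _)
  have hNpos : (0 : ℝ) < (N : ℝ) := by exact_mod_cast lt_of_lt_of_le zero_lt_one hN1
  have hT : 0 < min T₀ T₁ := lt_min hT₀ hT₁
  have h1 : e ≤ escapeDeficit 1 1 1 1 (min T₀ T₁) N := hPT (min T₀ T₁) hT (min_le_right _ _)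
  have h2 : escapeDeficit 1 1 1 1 (min T₀ T₁) N ≤ C₁ / (N : ℝ) := hU1 (min T₀ T₁) hT (min_le_left _ _) N hN₁
  have hne : e ≠ 0 := he.ne'
  have hCe : C₁ < e * (N : ℝ) := by
    have h' : C₁ / e < (N : ℝ) := lt_of_lt_of_le hM (by exact_mod_cast hMN)
    calc C₁ = e * (C₁ / e) := by field_simp
      _ < e * (N : ℝ) := mul_lt_mul_of_pos_left h' he
  have h3 : C₁ / (N : ℝ) < e := by
    rw [div_lt_iff₀ hNpos]
    linarith
  linarith

/-- **Every window rung refutes the `T`-uniform Ohmic floor.** [folklore] -/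
theorem not_uniformOhmicFloor_of_window (α : ℝ) : HarmonicPersistenceWindow α → ¬ UniformOhmicFloor :=
  fun h => not_uniformOhmicFloor_of_pointwise (pointwiseHarmonicLimit_of_window α h)

/-- **The negative split, assembled**: the two attackable halves refute the uniform floor. [folklore] -/
theorem not_uniformOhmicFloor_of_floor_continuity :
    HarmonicEscapeFloor → LowTemperatureContinuity → ¬ UniformOhmicFloor :=
  fun hF hC => not_uniformOhmicFloor_of_pointwise (pointwiseHarmonicLimit_of_floor_continuity hF hC)

end EscapeGrading

end Summit.AtomisticToContinuum.FouriersLaw.Theorems.SubdiffusiveBondHeat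

end
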